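import Literature.Geometry.Kaehler.ComplexTorusMonodromyStableHodgeClasses
import Literature.LinearAlgebra.Matrix.SymplecticCongruenceSubgroup
import HarnessLib

/-!
# Hodge classes stable under a level-`N` monodromy group are multiples of `E^{∧p}` (Lange Thm. 7.3.4, density
# step, with level structure)

Layer `Literature/Geometry/Kaehler`, namespace `Literature.Geometry.Kaehler.ComplexTorus`; lane `lit-hodgefound`
(Track 2), Layer A4, row **A4-39** (viii) of `run/shared/lean/pub/lit-hodgefound/SKELETON.md` (§A4-DETAIL).
THEOREMS ONLY. Sibling of `ComplexTorusMonodromyStableHodgeClasses` (§5 basis-free form for the full integral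
symplectic group `Sp(Λ, E)`; §7 finite-index subgroups in a symplectic lattice basis) and of
`LinearAlgebra/Matrix/SymplecticCongruenceSubgroup` (`Γ(N) ⊆ Sp_{2l}(ℤ)`, finite index, Zariski dense).

**What is proved (basis-free, level `N ≥ 1`).** On a principally polarised complex torus `(X = E/Φ(ℤ^ι), η)`
(ANY lattice basis `Φ`), let `W ⊆ H^{2p}_Hodge(X)` be a `ℚ`-subspace stable under pull-back by every real-linear
`T : E → E` which preserves `η` and is CONGRUENT TO THE IDENTITY MODULO `N` ON THE LATTICE
(`T(λ_m) = λ_{m + N n}`): the level-`N` subgroup `Sp(Λ, E)(N)` of the integral symplectic group, through which the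
monodromy of the universal family of principally polarised abelian varieties / Jacobians with level-`N`
structure acts. Then every element of `W` is a rational multiple of `E^{∧p}` and `W ≤ Dᵖ(X)`
(`IsPrincipalPolarization.le_divisorClasses_of_level_stable`); complex version for `(p,p)`-forms
(`IsPrincipalPolarization.le_span_wedgePow_of_level_stable`). Proof: in a symplectic lattice basis `Ψ`
(`IsPrincipalPolarization.exists_symplectic_presentation`) the matrices of `Γ(N) = congruenceSubgroup (Fin g) N`
act by such `T` (`realRep_mem_levelSp_of_mem_congruenceSubgroup`), and `Γ(N)` is of finite index and Zariski
dense in `Sp_{2g}(ℝ)` (Margulis I (3.2.11)), so `ComplexTorusMonodromyStableHodgeClasses` §7 applies.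

## References

* [Lange2023AbelianVarietiesComplex] H. Lange, *Abelian Varieties over the Complex Numbers* (2023), §7.3.2
  Thm. 7.3.4 (proof, p. 341), Lemma 7.3.7.
* [Margulis1991] G. A. Margulis, *Discrete Subgroups of Semisimple Lie Groups* (1991), Chap. I (3.1.1),
  Prop. (3.2.11).
-/

noncomputable section

open Matrix Complex Module
open Literature.Analysis.Complex (IsOfTypeAt)
open Literature.LinearAlgebra.Matrix

namespace Literature.Geometry.Kaehler.ComplexTorus

variable {E : Type*} [NormedAddCommGroup E] [NormedSpace ℂ E]

/-- `λ_{m + N n} = λ_m + N λ_n` for lattice vectors. [folklore] -/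
private theorem latticeVec_add_zsmul {ι : Type*} (Φ : (ι → ℝ) ≃L[ℝ] E) (m n : ι → ℤ) (N : ℤ) :
    latticeVec Φ (m + N • n) = latticeVec Φ m + (N : ℝ) • latticeVec Φ n := by
  simp only [latticeVec, ← map_smul, ← map_add]
  congr 1
  funext i
  simp [Pi.add_apply, Pi.smul_apply, smul_eq_mul, Int.cast_add, Int.cast_mul]

/-- In a symplectic lattice basis `Ψ` (same lattice as `Φ`), a matrix of the level-`N` congruence subgroup
`Γ(N) ⊆ Sp_{2g}(ℤ)` acts on `E` preserving `η` and congruent to the identity modulo `N` on the lattice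
`Λ = Φ(ℤ^ι)`: `ρ_ℝ(M)(λ_m) = λ_{m + N n}`. [cite: Margulis1991, Chap. I (3.1.1)]
[cite: Lange2023AbelianVarietiesComplex, §7.3.2 Thm. 7.3.4 (proof, p. 341)] -/
theorem realRep_mem_levelSp_of_mem_congruenceSubgroup {ι : Type*} [Fintype ι] [DecidableEq ι]
    {Φ : (ι → ℝ) ≃L[ℝ] E} {η : E [⋀^Fin 2]→L[ℝ] ℝ} {g : ℕ} {Ψ : (Fin g ⊕ Fin g → ℝ) ≃L[ℝ] E}
    (hr : Set.range (latticeVec Ψ) = Set.range (latticeVec Φ))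
    (hB : ∀ x y, η ![Ψ x, Ψ y] = -(x ⬝ᵥ (Matrix.J (Fin g) ℝ *ᵥ y))) {N : ℕ}
    {M : Matrix.symplecticGroup (Fin g) ℤ} (hM : M ∈ SymplecticMatrix.congruenceSubgroup (Fin g) N) :
    (∀ u v : E, η ![realRep Ψ Ψ (M : Matrix _ _ ℤ) u, realRep Ψ Ψ (M : Matrix _ _ ℤ) v] = η ![u, v]) ∧
      ∀ m : ι → ℤ, ∃ n : ι → ℤ, realRep Ψ Ψ (M : Matrix _ _ ℤ) (latticeVec Φ m) = latticeVec Φ (m + (N : ℤ) • n) := by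
  refine ⟨(realRep_mem_latticeSp_of_mem_symplecticGroup hr hB M.2).1, fun m ↦ ?_⟩
  -- `M - 1 = N Q` entrywise
  have hdvd := SymplecticMatrix.mem_congruenceSubgroup_iff.1 hM
  choose Q hQ using hdvd
  have hM1 : ∀ v : Fin g ⊕ Fin g → ℤ, (M : Matrix _ _ ℤ) *ᵥ v = v + (N : ℤ) • (Matrix.of Q *ᵥ v) := by
    intro v
    have hsub : (M : Matrix _ _ ℤ) = 1 + (N : ℤ) • Matrix.of Q := by
      ext i j
      have h := hQ i j
      rw [Matrix.sub_apply] at h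
      rw [Matrix.add_apply, Matrix.smul_apply, Matrix.of_apply, smul_eq_mul, ← h]
      ring
    rw [hsub, Matrix.add_mulVec, Matrix.one_mulVec, Matrix.smul_mulVec]
  obtain ⟨m', hm'⟩ : latticeVec Φ m ∈ Set.range (latticeVec Ψ) := hr ▸ ⟨m, rfl⟩
  obtain ⟨n, hn⟩ : latticeVec Ψ (Matrix.of Q *ᵥ m') ∈ Set.range (latticeVec Φ) := hr ▸ ⟨_, rfl⟩
  refine ⟨n, ?_⟩
  rw [← hm', realRep_latticeVec, hM1, latticeVec_add_zsmul, ← hn, hm', ← latticeVec_add_zsmul]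

variable [FiniteDimensional ℂ E]

/-- **Lemma 7.3.7 / Thm. 7.3.4 density step WITH LEVEL STRUCTURE, complex form**: on a principally polarised
complex torus, a complex subspace `W` of `(p,p)`-forms stable under pull-back by every `η`-preserving real-linear
`T` congruent to the identity modulo `N` on the lattice (`N ≥ 1`) satisfies `W ≤ ℂ · E^{∧p}` and `dim_ℂ W ≤ 1`.
[cite: Lange2023AbelianVarietiesComplex, §7.3.2 Lemma 7.3.7 and Thm. 7.3.4 (proof, p. 341)]
[cite: Margulis1991, Chap. I Prop. (3.2.11)] -/
theorem IsPrincipalPolarization.le_span_wedgePow_of_level_stable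
    {ι : Type*} [Fintype ι] [DecidableEq ι] {Φ : (ι → ℝ) ≃L[ℝ] E} {η : E [⋀^Fin 2]→L[ℝ] ℝ}
    (hη : IsPrincipalPolarization Φ η) (N : ℕ) [NeZero N] {p : ℕ} (W : Submodule ℂ (E [⋀^Fin (2 * p)]→L[ℝ] ℂ))
    (hW : ∀ T : E →L[ℝ] E, (∀ u v : E, η ![T u, T v] = η ![u, v]) →
      (∀ m : ι → ℤ, ∃ n : ι → ℤ, T (latticeVec Φ m) = latticeVec Φ (m + (N : ℤ) • n)) →
      ∀ w ∈ W, w.compContinuousLinearMap T ∈ W)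
    (hpp : ∀ w ∈ W, IsOfTypeAt p p w) :
    W ≤ ℂ ∙ wedgePow (ofRealForm η) p ∧ Module.finrank ℂ W ≤ 1 := by
  obtain ⟨g, Ψ, hr, hΨ, hB⟩ := hη.exists_symplectic_presentation
  exact hΨ.le_span_wedgePow_of_finiteIndex_stable hB (SymplecticMatrix.congruenceSubgroup (Fin g) N) W
    (fun M hM ↦ hW _ (realRep_mem_levelSp_of_mem_congruenceSubgroup hr hB hM).1
      (realRep_mem_levelSp_of_mem_congruenceSubgroup hr hB hM).2) hpp

/-- **Thm. 7.3.4 density step WITH LEVEL STRUCTURE, rational form**: on a principally polarised complex torus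
`(X, η)`, every Hodge class in a `ℚ`-subspace `W ⊆ H^{2p}_Hodge(X)` stable under the level-`N` subgroup
`Sp(Λ, E)(N)` of the integral symplectic group (`η`-preserving real-linear maps congruent to the identity modulo
`N` on the lattice; `N ≥ 1`) is a rational multiple of `E^{∧p}`, and **`W ≤ Dᵖ(X)`** (these classes are
algebraic). [cite: Lange2023AbelianVarietiesComplex, §7.3.2 Thm. 7.3.4 (proof, p. 341)]
[cite: Margulis1991, Chap. I Prop. (3.2.11)] -/
theorem IsPrincipalPolarization.le_divisorClasses_of_level_stable
    {ι : Type*} [Fintype ι] [DecidableEq ι] {Φ : (ι → ℝ) ≃L[ℝ] E} {η : E [⋀^Fin 2]→L[ℝ] ℝ}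
    (hη : IsPrincipalPolarization Φ η) (N : ℕ) [NeZero N] {p : ℕ} (W : Submodule ℚ (E [⋀^Fin (2 * p)]→L[ℝ] ℂ))
    (hWH : W ≤ hodgeClasses Φ p)
    (hW : ∀ T : E →L[ℝ] E, (∀ u v : E, η ![T u, T v] = η ![u, v]) →
      (∀ m : ι → ℤ, ∃ n : ι → ℤ, T (latticeVec Φ m) = latticeVec Φ (m + (N : ℤ) • n)) →
      ∀ w ∈ W, w.compContinuousLinearMap T ∈ W) :
    (∀ w ∈ W, ∃ q : ℚ, w = (q : ℂ) • wedgePow (ofRealForm η) p) ∧ W ≤ divisorClasses Φ p := by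
  obtain ⟨g, Ψ, hr, hΨ, hB⟩ := hη.exists_symplectic_presentation
  have hWH' : W ≤ hodgeClasses Ψ p := by rwa [hodgeClasses_eq_of_range_latticeVec_eq hr p]
  have hW' : ∀ M : Matrix.symplecticGroup (Fin g) ℤ, M ∈ SymplecticMatrix.congruenceSubgroup (Fin g) N →
      ∀ w ∈ W, w.compContinuousLinearMap (realRep Ψ Ψ (M : Matrix _ _ ℤ)) ∈ W := fun M hM ↦
    hW _ (realRep_mem_levelSp_of_mem_congruenceSubgroup hr hB hM).1
      (realRep_mem_levelSp_of_mem_congruenceSubgroup hr hB hM).2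
  have hq := (hΨ.le_divisorClasses_of_finiteIndex_stable hB (SymplecticMatrix.congruenceSubgroup (Fin g) N)
    W hWH' hW').1
  refine ⟨hq, fun w hw ↦ ?_⟩
  -- `E^{∧p} ∈ Dᵖ(X)` in the presentation `Φ`
  obtain ⟨q, hwq⟩ := hq w hw
  rw [hwq, Rat.cast_smul_eq_qsmul]
  exact Submodule.smul_mem _ q (wedgePow_mem_divisorClasses Φ (IsRiemannForm.isNSForm Φ hη.isRiemannForm) p)

end Literature.Geometry.Kaehler.ComplexTorus
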